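import Summits.BirchSwinnertonDyer.BirchSwinnertonDyer.Theorems.SemiOrdinaryEisensteinDescentWildKolyvaginUpperAtThreeTowerFreeJetchevMaxModThree
import Summits.BirchSwinnertonDyer.BirchSwinnertonDyer.Theorems.PoitouTateSelmerStructureDualityConjHolds
import Literature.NumberTheory.EllipticCurves.TamagawaRingEquivProofs
import Literature.NumberTheory.EllipticCurves.TamagawaSubgroupProofs
import Literature.NumberTheory.EllipticCurves.TamagawaNeZeroProofs
import Literature.NumberTheory.EllipticCurves.ModularityVersionApProofs
import Literature.NumberTheory.EllipticCurves.NoConductorOne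
import Literature.NumberTheory.DiophantineGeometry.Conductor
import Literature.NumberTheory.EllipticCurves.TamagawaFiniteIndexProofs
import HarnessLib

/-!
# Negative-lane lemmas for crux J‴ `SemiOrdinaryEisensteinDescent.WildSigmaDivisibilityAtThreeMultiCarrier`
# (stmt-BirchSwinnertonDyer-25898): (C) on a FLAT multi-carrier frame there IS a Tamagawa `3`-carrier, the depth is `≥ 2`,
# and — modulo the two print facts E0 / 3.7(2) — the Heegner classes are already `3`-divisible at every level
# (so the integrality pin «`y_K ∉ 3E(K)`» of the tempered Λ-adic road is FALSE on the whole habitat of `stub_flatMultiCarrier`)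

Width seat `bsd-wall-soed-p2-w2` g14 (lead-of-record lineage of the crux; 2026-08-28), `--supports` stmt-BirchSwinnertonDyer-25898.
Companion of `…Negative.ScalingSlackOneAndLevelOne` (parts (A), (B)) and of the barrier entry
`Literature.Barriers.BirchSwinnertonDyer.TraceZeroHeegnerTowerAtAdditiveSplitP` (p658980): that entry records that the only printed
evasion of `StringentKolyvaginCapsAtMax` (anticyclotomic IMC + control) has no integral Λ-adic Heegner class at the additive split prime
`3`, and that the tempered substitute (route CumulativeHeegnerLeopoldt's cumulative class `κ♮`) is integral only after a pin such as
«`y_K ∉ pE(K)`». This file certifies, in the crux's own binders, that the pin fails on EVERY frame of the registered research stub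
`stub_flatMultiCarrier` (line `birth` v3): nothing here refutes the crux (open research) and nothing asserts a route statement positively.

* `exists_prime_dvd_localTamagawa_of_prime_dvd_tamagawaProduct` (general, `E/ℚ`): a prime `ℓ ∣ ∏_v c_v` divides some `p`-adic local
  Tamagawa number `c_q` at a prime `q ∣ N_E` (the Tamagawa product is the finite product of the `c_v`, `c_v = 1` at good places,
  `q ∣ N_E` iff bad reduction).
* `one_le_padicValNat_tamagawaProduct_of_flatMultiCarrier`, `exists_carrier_of_flatMultiCarrier`, `two_le_depth_of_flatMultiCarrier`:
  on a frame with `N_E = N`, `¬ 3 ∣ c(Dt)` and the multi-carrier cut `∀ q ∣ N, ord₃ c_q < t := ord₃ ∏ c_v + v₃ c(Dt)`, one has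
  `3 ∣ ∏ c_v`, some `q ∣ N` with `3 ∣ c_q`, and `t = ord₃ ∏ c_v ≥ 2` (no elliptic curve over `ℚ` has conductor `1`, so the cut is
  not vacuous; one carrier has `1 ≤ ord₃ c_q < t`).
* `pDiv_one_of_flatMultiCarrier_of_print`: `Gross1991_heegnerPoint_sub_ratTorsion_mem_E0 → GrossLMS1991.prop37_2_frobeniusCongruence →`
  on every frame of `stub_flatMultiCarrier`, for every square-free Kolyvagin `n` (indices `≥ 1`) and every datum `d`,
  `Koly.PDiv d 3 1` — Jetchev's max-form at the carrier found above (`…TowerFreeJetchevMaxModThree.jetchevMaxModThree_of_literature`,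
  the theorem behind the closed item 25897; Poitou–Tate input = `InputsPoitouTateSelmer.poitouTate_selmerStructure_duality_conj_holds`).
  No route file is imported (route-independent module; the two antecedents are what SOED's `GrossHeegnerPointE0Input` /
  `GrossProp372FrobeniusCongruenceInput` unfold to).
  At `n = 1` this reads `y_K ∈ 3·E(K[1])`: the bottom-layer indivisibility pin is unavailable on the habitat (card `Lines/birth.md`
  row (e); memo `Cruxes/WildSigmaDivisibilityAtThreeMultiCarrier/LAMBDA-ROAD-TRACEZERO-w2g14.md`).
BSD is not proved by anything here; J‴ stays OPEN research. [folklore]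
-/

-- single-conjunct summit: `Summit.BirchSwinnertonDyer.BirchSwinnertonDyer.…` repeats the name by design (tree layout D-0017)
set_option linter.dupNamespace false

noncomputable section

open scoped Classical

namespace Summit.BirchSwinnertonDyer.BirchSwinnertonDyer.Theorems.WildSigmaDivisibilityAtThreeMultiCarrierFlatFrameCarriers

open WeierstrassCurve NumberField IsDedekindDomain
  Literature.NumberTheory.EllipticCurves
  Literature.NumberTheory.EllipticCurves.ModularForms
  Summit.BirchSwinnertonDyer.Rank1Residual
  Summit.BirchSwinnertonDyer.Rank1Residual.Additive
  Summit.BirchSwinnertonDyer.Rank1Residual.X11b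
  Summit.BirchSwinnertonDyer.Rank1Residual.X11b.Three

/-! ## §C.1 A prime dividing the Tamagawa product divides a local Tamagawa number at a bad prime -/

/-- **`ℓ ∣ ∏_v c_v ⇒ ℓ ∣ c_q` for some prime `q ∣ N_E`.** The Tamagawa product of `E/ℚ` is the finite product of the local
Tamagawa numbers over the places of `𝓞 ℚ` (`mulSupport_localTamagawaNumber_finite_holds`), so a prime divisor `ℓ` divides one
factor `c_v`; that factor is not `1`, so `v` is a place of bad reduction (`localTamagawaNumber_eq_one_of_hasGoodReductionAt_holds`),
i.e. the prime `q` below `v` divides the conductor (`dvd_conductorNorm_iff`); finally `c_v = c_q` in `p`-adic currency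
(`localTamagawaNumber_padic_eq_holds`). [cite: SilvermanAEC2009, Cor. VII.6.2 and VII.2 (remark after Prop. 2.1)] -/
theorem exists_prime_dvd_localTamagawa_of_prime_dvd_tamagawaProduct (W : WeierstrassCurve ℚ) [W.IsElliptic]
    {ℓ : ℕ} (hℓ : ℓ.Prime) (h : ℓ ∣ W.tamagawaProduct) :
    ∃ (q : ℕ) (_ : Fact q.Prime), q ∣ W.conductorNorm ℤ ∧ ℓ ∣ (W.baseChange ℚ_[q]).localTamagawaNumber ℤ_[q] := by
  have hfin := W.mulSupport_localTamagawaNumber_finite_holds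
  have hprod : W.tamagawaProduct = ∏ v ∈ hfin.toFinset,
      (W.baseChange (v.adicCompletion ℚ)).localTamagawaNumber (v.adicCompletionIntegers ℚ) := by
    unfold WeierstrassCurve.tamagawaProduct
    exact finprod_eq_prod _ hfin
  rw [hprod] at h
  obtain ⟨v, -, hv⟩ := (Nat.prime_iff.mp hℓ).exists_mem_finset_dvd h
  haveI hq : Fact (Nat.Prime (Rat.HeightOneSpectrum.primesEquiv v : ℕ)) := ⟨(Rat.HeightOneSpectrum.primesEquiv v).2⟩
  refine ⟨(Rat.HeightOneSpectrum.primesEquiv v : ℕ), hq, ?_, ?_⟩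
  · rw [W.dvd_conductorNorm_iff v]
    intro hgood
    rw [W.localTamagawaNumber_eq_one_of_hasGoodReductionAt_holds v hgood] at hv
    exact hℓ.not_dvd_one hv
  · rwa [WeierstrassCurve.localTamagawaNumber_padic_eq_holds W v _ rfl]

/-! ## §C.2 Flat multi-carrier frames: the depth is at least two and a carrier exists -/

section Frame

variable {W : WeierstrassCurve ℚ} [W.IsElliptic] [W.IsGloballyMinimal] {N : ℕ} [NeZero N]
  {Dt : ModularParametrizationData W N}

/-- On a frame with `N_E = N` and the multi-carrier cut, `3 ∣ ∏_v c_v` as soon as the datum is flat (`¬ 3 ∣ c(Dt)`): the cut at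
any prime `q ∣ N` (one exists: `N_E ≠ 1`, `conductorNorm_ne_one`) reads `0 ≤ ord₃ c_q < ord₃ ∏ c_v + 0`. [folklore] -/
theorem one_le_padicValNat_tamagawaProduct_of_flatMultiCarrier (hN : W.conductorNorm ℤ = N) (hflat : ¬ (3 : ℤ) ∣ Dt.c)
    (hmc : ∀ (q : ℕ) [Fact q.Prime], q ∣ N →
      padicValNat 3 ((W.baseChange ℚ_[q]).localTamagawaNumber ℤ_[q]) <
        padicValNat 3 W.tamagawaProduct + padicValNat 3 Dt.c.natAbs) :
    1 ≤ padicValNat 3 W.tamagawaProduct := by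
  have h3 : ¬ 3 ∣ Dt.c.natAbs := fun h => hflat (by exact_mod_cast Int.natCast_dvd.mpr h)
  have hc0 : padicValNat 3 Dt.c.natAbs = 0 := padicValNat.eq_zero_of_not_dvd h3
  have hN1 : N ≠ 1 := hN ▸ conductorNorm_ne_one W
  obtain ⟨q, hq, hqN⟩ := Nat.exists_prime_and_dvd hN1
  haveI := Fact.mk hq
  have hlt := hmc q hqN
  rw [hc0, add_zero] at hlt
  omega

/-- **A Tamagawa `3`-carrier exists on every flat multi-carrier frame**: some prime `q ∣ N` has `1 ≤ ord₃ c_q(E/ℚ_q)`.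
[folklore] -/
theorem exists_carrier_of_flatMultiCarrier (hN : W.conductorNorm ℤ = N) (hflat : ¬ (3 : ℤ) ∣ Dt.c)
    (hmc : ∀ (q : ℕ) [Fact q.Prime], q ∣ N →
      padicValNat 3 ((W.baseChange ℚ_[q]).localTamagawaNumber ℤ_[q]) <
        padicValNat 3 W.tamagawaProduct + padicValNat 3 Dt.c.natAbs) :
    ∃ (q : ℕ) (_ : Fact q.Prime), q ∣ N ∧ 1 ≤ padicValNat 3 ((W.baseChange ℚ_[q]).localTamagawaNumber ℤ_[q]) := by
  haveI : Fact (Nat.Prime 3) := ⟨Nat.prime_three⟩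
  have h1 := one_le_padicValNat_tamagawaProduct_of_flatMultiCarrier hN hflat hmc
  have hdvd : 3 ∣ W.tamagawaProduct :=
    (dvd_iff_padicValNat_ne_zero (W.tamagawaProduct_pos').ne').mpr (by omega)
  obtain ⟨q, hq, hqN, hcq⟩ := exists_prime_dvd_localTamagawa_of_prime_dvd_tamagawaProduct W Nat.prime_three hdvd
  exact ⟨q, hq, hN ▸ hqN,
    one_le_padicValNat_of_dvd (WeierstrassCurve.localTamagawaNumber_padic_ne_zero_holds q (W.baseChange ℚ_[q])) hcq⟩

/-- **The depth of a flat multi-carrier frame is at least two**: `2 ≤ ord₃ ∏_v c_v` (the carrier of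
`exists_carrier_of_flatMultiCarrier` has `1 ≤ ord₃ c_q < t = ord₃ ∏ c_v`). On the census habitat `t = 2` on 2 932 / 3 413
classes (memo DEPTH2-PROFILE-w2g10). [folklore] -/
theorem two_le_depth_of_flatMultiCarrier (hN : W.conductorNorm ℤ = N) (hflat : ¬ (3 : ℤ) ∣ Dt.c)
    (hmc : ∀ (q : ℕ) [Fact q.Prime], q ∣ N →
      padicValNat 3 ((W.baseChange ℚ_[q]).localTamagawaNumber ℤ_[q]) <
        padicValNat 3 W.tamagawaProduct + padicValNat 3 Dt.c.natAbs) :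
    2 ≤ padicValNat 3 W.tamagawaProduct := by
  have h3 : ¬ 3 ∣ Dt.c.natAbs := fun h => hflat (by exact_mod_cast Int.natCast_dvd.mpr h)
  have hc0 : padicValNat 3 Dt.c.natAbs = 0 := padicValNat.eq_zero_of_not_dvd h3
  obtain ⟨q, hq, hqN, hcq⟩ := exists_carrier_of_flatMultiCarrier hN hflat hmc
  have hlt := hmc q hqN
  rw [hc0, add_zero] at hlt
  omega

end Frame

/-! ## §C.3 The pin fails: depth-one divisibility at every level, modulo the two print facts -/

/-- **On every frame of `stub_flatMultiCarrier` the Kolyvagin classes are `3`-divisible at every square-free Kolyvagin level with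
indices `≥ 1` — modulo Gross's E⁰ sentence (24701) and Prop. 3.7 (2) (23091).** The binders are those of the registered stub
(line `birth` v3 of stmt-BirchSwinnertonDyer-25898) with the depth fixed to `1`; the proof feeds the carrier of
`exists_carrier_of_flatMultiCarrier` to Jetchev's max-form at `3 ∣ N` under `ρ̄₃` onto
(`WildKolyvaginUpperAtThreeTowerFreeJetchevMaxModThree.jetchevMaxModThree_of_literature`, the theorem behind the CLOSED item 25897),
its conjugation-compatible Poitou–Tate input discharged by `InputsPoitouTateSelmer.poitouTate_selmerStructure_duality_conj_holds`
(THE canonical local invariants; no route file is imported, so the lemma is insulated from route edits and its two print antecedents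
are the Literature facts that the route defs `GrossHeegnerPointE0Input` / `GrossProp372FrobeniusCongruenceInput` unfold to). At `n = 1` this is `y_K ∈ 3·E(K[1])`: the
bottom-layer indivisibility pin «`y_K ∉ 3E(K)`» of the tempered Λ-adic road (route CumulativeHeegnerLeopoldt) is unavailable on the
habitat of J‴ (barrier `Literature.Barriers.BirchSwinnertonDyer.TraceZeroHeegnerTowerAtAdditiveSplitP`, evasion (ii)).
[cite: Jetchev2008, Thm. 1.4 (p. 812)] [cite: GrossLMS1991, Prop. 3.7 (2) p. 240 and §6 p. 245] -/
theorem pDiv_one_of_flatMultiCarrier_of_print :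
    Gross1991_heegnerPoint_sub_ratTorsion_mem_E0 → GrossLMS1991.prop37_2_frobeniusCongruence →
    ∀ (W : WeierstrassCurve ℚ) [W.IsElliptic] [W.IsGloballyMinimal] (N : ℕ) [NeZero N] (K : Type) [Field K] [NumberField K]
      (Dt : ModularParametrizationData W N) (H : HeegnerDatum N (NumberField.discr K)) (ι : K →+* ℂ)
      (P : (W.baseChange K).toAffine.Point),
      ClassO6 W 3 → W.HasSurjectiveModNGaloisRep 3 → W.analyticRank = 1 → W.conductorNorm ℤ = N →
      IsImaginaryQuadratic K → SatisfiesHeegnerHypothesis N K →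
      (W.quadraticTwist (NumberField.discr K : ℚ)).entireLFunction 1 ≠ 0 →
      WeierstrassCurve.Affine.Point.map ι.toRatAlgHom P = heegnerPointComplex Dt H → ¬ IsOfFinAddOrder P →
      Odd (NumberField.discr K) → NumberField.discr K ≠ -3 → ¬ (3 : ℤ) ∣ Dt.c →
      (∀ (q : ℕ) [Fact q.Prime], q ∣ N →
        padicValNat 3 ((W.baseChange ℚ_[q]).localTamagawaNumber ℤ_[q]) <
          padicValNat 3 W.tamagawaProduct + padicValNat 3 Dt.c.natAbs) →
      ∀ (n : ℕ) (d : KolyvaginHeegnerData Dt H.β ι n), Squarefree n →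
        (∀ ℓ ∈ n.primeFactors, Zhang2014.IsKolyvaginPrime N W K 3 ℓ ∧ 1 ≤ Zhang2014.kolyvaginIndex W 3 ℓ) →
        Koly.PDiv d 3 1 := by
  intro hE0 h372 W _ _ N _ K _ _ Dt H ι P h1 h2 h3 hN h5 h6 h7 h8 h9 h10 h11 hflat hmc n d hn hKol
  obtain ⟨q, hq, hqN, hcq⟩ := exists_carrier_of_flatMultiCarrier hN hflat hmc
  haveI := hq
  exact WildKolyvaginUpperAtThreeTowerFreeJetchevMaxModThree.jetchevMaxModThree_of_literature
    (fun K' _ _ => InputsPoitouTateSelmer.poitouTate_selmerStructure_duality_conj_holds K')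
    hE0 h372 W N K Dt H ι P h1 h2 h3 hN h5 h6 h7 h8 h9 h10 h11 q hqN 1 hcq n d hn hKol

end Summit.BirchSwinnertonDyer.BirchSwinnertonDyer.Theorems.WildSigmaDivisibilityAtThreeMultiCarrierFlatFrameCarriers

end
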